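/-
Copyright (c) 2026. All rights reserved.
Released under Apache 2.0 license as described in the file LICENSE.
Authors: abc-iut cell, seat abc-iut-f-069 (gen 7; row «CT2b / G-L4t6g8-2 residual», file 5 of 6).
-/
import Literature.AnabelianGeometry.AbsoluteAnabelian.AbsTopII.DehnTwistInvariantChainVanishing
import Literature.AnabelianGeometry.AbsoluteAnabelian.AbsTopII.DehnTwistLoopProp13viiiOfCT2
import HarnessLib

/-!
# CT2 at the nodal Dehn-twist datum, cases: `Ẑ`-arithmetic, twisted fixed vertices (TFV), the non-fibre and fibre primes

S. Mochizuki, *Topics in Absolute Anabelian Geometry II* [AbsTopII] (`MochizukiAbsTopII2013`) §1 Prop 1.3 (viii) p. 12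
("`I_v = D_e ∩ D_{e'} ∩ Π_I`"), at the nodal Dehn-twist datum (abc-iut-L4-t6 `DehnTwistLoopDatum`: `Π_𝔾 = F̂₂ = ⟨a,b⟩^`,
`Π_e = b^Ẑ`, `Π_v = ⟨b^Ẑ, ab^Ẑa⁻¹⟩^`, `Π_I = F̂₂ ⋊_{shear^i} Ẑ`); Ribes–Zalesskii Thm 2.7.1 (`Ẑ ≅ ∏_p ℤ_p`)
[cite: RibesZalesskii2010, Thm 2.7.1].
PROOF-ONLY file (no definition, no instance, no notation), abc-iut-f-069 (gen 7); file 5 of the chain closing the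
residual «CT2» of GAP row G-L4t6g8-2 (hypothesis of L4-t6's `prop_1_3_viii'_dpsc_of_CT2`, p487638): the CT2 equation
`shear^i(k) x = b^{-u} x b^{u}` is treated prime by prime in `Ẑ ≅ ∏_p ℤ_p` (`m := k^i`).
* `Ẑ`-ARITHMETIC: `toAdd_apply_continuousMonoidHom` (a continuous `K : Ẑ → Ẑ` is componentwise multiplication by
  `K(1)`), `apply_ne_one_of_ellType` / `apply_eq_one_of_ellType` ((A1)/(A2): for `ν ≠ 1` divisible by every `r` prime to
  `ℓ`, `K ν ≠ 1` iff `K(1)` is not `ℓ`-divisible), `exists_prime_not_ellDiv`;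
* `shear_eq_mul_bPow_imp` — **TFV (twisted fixed vertices)**: `shear_M y = y b^P`, `M ≠ 1` ⇒ (`P = 1`, `y ∈ Π_v`) or
  (`P = M`, `y ∈ Π_v a b^Ẑ`) (file 4 «FREE OFF `Π_v`» for `i = 1` + CT0-EXOTIC `mem_vertGp_of_shear_eq`, L4-t6 p486978);
* `mem_nodeGp_of_conj_shear_eq_of_not_ellDiv` — **case B** (a prime `ℓ` where none of `m`, `u`, `u m⁻¹` is
  `ℓ`-divisible: by TFV + (A1) every point is `ℓ`-free ⇒ «FREE EVERYWHERE» ⇒ `x ∈ b^Ẑ`);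
  `mem_nodeGp_of_conj_shear_eq_of_ellDiv` — **case C1** (`m` not, `u` `ℓ`-divisible: `σ_ν` is a pure shear for `ℓ`-type
  `ν` by (A2), free off `Π_v` by CT0-EXOTIC ⇒ «FREE OFF `Π_v`» ⇒ `x ∈ Π_v` (then `x` commutes with `b^u`, malnormality) or
  `x = p a b^t` (absurd: `b^u ∈ b^Ẑ ∩ (pa) b^Ẑ (pa)⁻¹ = 1`)).
The remaining case C2 (`u m⁻¹` `ℓ`-divisible) is C1 for the image under `a ↦ a⁻¹, b ↦ b`: file 6, with `CT2_holds`.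
HONEST FRAMING: classical profinite group theory under OUR kernel check, at a constructed model (constructed ≠ geometric);
nothing here bears on [IUTchIII] Cor 3.12; no side taken.
-/

noncomputable section

open scoped Pointwise

namespace Literature.AnabelianGeometry.AbsoluteAnabelian.AbsTopII.DehnTwist

open Literature.AnabelianGeometry.EtaleTheta.SettingModel
open Literature.AnabelianGeometry.EtaleTheta
open Literature.AnabelianGeometry.AbsoluteAnabelian
open Literature.GroupTheory.CombinatorialGroupTheory.FoxChain
open Function _root_.Topology

variable {i : ℕ}

/-! ### §1 `Ẑ`-arithmetic: `ℓ`-type elements, `ℓ`-divisible elements, continuous endomorphisms -/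

section ZHatArith

/-- In `ℤ_p`, an element divisible by every power of `p` is `0` (valuations). [cite: RibesZalesskii2010, Thm 2.7.1] -/
theorem padicInt_eq_zero_of_forall_dvd {p : ℕ} [hp : Fact p.Prime] {x : ℤ_[p]}
    (h : ∀ t : ℕ, ∃ y : ℤ_[p], x = (p : ℤ_[p]) ^ t * y) : x = 0 := by
  by_contra hx
  obtain ⟨y, hy⟩ := h (x.valuation + 1)
  have hy0 : y ≠ 0 := by rintro rfl; exact hx (by rw [hy, mul_zero])
  have hp0 : (p : ℤ_[p]) ^ (x.valuation + 1) ≠ 0 := pow_ne_zero _ (by exact_mod_cast hp.out.ne_zero)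
  have hv := congrArg PadicInt.valuation hy
  rw [PadicInt.valuation_mul hp0 hy0, PadicInt.valuation_pow, PadicInt.valuation_p, mul_one] at hv
  omega

/-- **A continuous endomorphism of `Ẑ` is componentwise multiplication by the image of `1`** (in `Ẑ ≅ ∏_p ℤ_p`): the
two sides are continuous homomorphisms agreeing at `η(1)`. [cite: RibesZalesskii2010, Thm 2.7.1] -/
theorem toAdd_apply_continuousMonoidHom
    (e : ZH ≃ₜ* Multiplicative (∀ p : Nat.Primes, @PadicInt (p : ℕ) ⟨p.2⟩))
    (he : Multiplicative.toAdd (e (iotaZ (Multiplicative.ofAdd 1))) = 1) (K : ZH →ₜ* ZH) (ν : ZH) (p : Nat.Primes) :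
    Multiplicative.toAdd (e (K ν)) p = Multiplicative.toAdd (e ν) p * Multiplicative.toAdd (e (K (iotaZ (Multiplicative.ofAdd 1)))) p := by
  haveI : Fact (Nat.Prime (p : ℕ)) := ⟨p.2⟩
  set c := Multiplicative.toAdd (e (K (iotaZ (Multiplicative.ofAdd 1)))) p with hc
  -- the two continuous homomorphisms `Ẑ → Multiplicative ℤ_p`
  let f₁ : ZH →* Multiplicative (@PadicInt (p : ℕ) ⟨p.2⟩) :=
    { toFun := fun ν => Multiplicative.ofAdd (Multiplicative.toAdd (e (K ν)) p)
      map_one' := by simp only [map_one, toAdd_one, Pi.zero_apply, ofAdd_zero]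
      map_mul' := fun a b => by simp only [map_mul, toAdd_mul, Pi.add_apply, ofAdd_add] }
  let f₂ : ZH →* Multiplicative (@PadicInt (p : ℕ) ⟨p.2⟩) :=
    { toFun := fun ν => Multiplicative.ofAdd (Multiplicative.toAdd (e ν) p * c)
      map_one' := by simp only [map_one, toAdd_one, Pi.zero_apply, zero_mul, ofAdd_zero]
      map_mul' := fun a b => by simp only [map_mul, toAdd_mul, Pi.add_apply, add_mul, ofAdd_add] }
  have hev : Continuous fun w : Multiplicative (∀ q : Nat.Primes, @PadicInt (q : ℕ) ⟨q.2⟩) => Multiplicative.toAdd w p :=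
    (continuous_apply p).comp continuous_toAdd
  have h₁ : Continuous f₁ := continuous_ofAdd.comp (hev.comp (e.continuous.comp K.continuous))
  have h₂ : Continuous f₂ := continuous_ofAdd.comp ((hev.comp e.continuous).mul continuous_const)
  have h := ZHatCompletion.monoidHom_ext_of_continuous (f₁ := f₁) (f₂ := f₂) h₁ h₂ (by
    show Multiplicative.ofAdd (Multiplicative.toAdd (e (K (iotaZ (Multiplicative.ofAdd 1)))) p) =
      Multiplicative.ofAdd (Multiplicative.toAdd (e (iotaZ (Multiplicative.ofAdd 1))) p * c)
    rw [he, Pi.one_apply, one_mul])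
  have := DFunLike.congr_fun h ν
  exact Multiplicative.ofAdd.injective this

/-- An element of `Ẑ` divisible by every `r` prime to `ℓ` has vanishing `p`-components for `p ≠ ℓ`.
[cite: RibesZalesskii2010, Thm 2.7.1] -/
theorem toAdd_apply_eq_zero_of_ellType (e : ZH ≃ₜ* Multiplicative (∀ p : Nat.Primes, @PadicInt (p : ℕ) ⟨p.2⟩))
    {ℓ : ℕ} (hℓ : ℓ.Prime) {ν : ZH} (hν : ∀ r : ℕ, 0 < r → ℓ.Coprime r → ∃ μ : ZH, μ ^ r = ν) (p : Nat.Primes)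
    (hp : (p : ℕ) ≠ ℓ) : Multiplicative.toAdd (e ν) p = 0 := by
  haveI : Fact (Nat.Prime (p : ℕ)) := ⟨p.2⟩
  refine padicInt_eq_zero_of_forall_dvd fun t => ?_
  obtain ⟨μ, hμ⟩ := hν ((p : ℕ) ^ t) (pow_pos p.2.pos t)
    ((Nat.coprime_primes hℓ p.2).mpr (Ne.symm hp) |>.pow_right t)
  refine ⟨Multiplicative.toAdd (e μ) p, ?_⟩
  rw [← hμ, map_pow, toAdd_pow, Pi.smul_apply, nsmul_eq_mul, Nat.cast_pow]

/-- An `ℓ`-divisible element of `Ẑ` (an `ℓ^t`-th power for every `t`) has vanishing `ℓ`-component.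
[cite: RibesZalesskii2010, Thm 2.7.1] -/
theorem toAdd_apply_eq_zero_of_ellDiv (e : ZH ≃ₜ* Multiplicative (∀ p : Nat.Primes, @PadicInt (p : ℕ) ⟨p.2⟩))
    (ℓ : Nat.Primes) {m : ZH} (hm : ∀ t : ℕ, ∃ μ : ZH, μ ^ ((ℓ : ℕ) ^ t) = m) :
    Multiplicative.toAdd (e m) ℓ = 0 := by
  haveI : Fact (Nat.Prime (ℓ : ℕ)) := ⟨ℓ.2⟩
  refine padicInt_eq_zero_of_forall_dvd fun t => ?_
  obtain ⟨μ, hμ⟩ := hm t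
  refine ⟨Multiplicative.toAdd (e μ) ℓ, ?_⟩
  rw [← hμ, map_pow, toAdd_pow, Pi.smul_apply, nsmul_eq_mul, Nat.cast_pow]

/-- Conversely: vanishing `ℓ`-component ⇒ `ℓ`-divisible (`ℓ` is a unit of `ℤ_p` for `p ≠ ℓ`). [cite: RibesZalesskii2010, Thm 2.7.1] -/
theorem ellDiv_of_toAdd_apply_eq_zero (e : ZH ≃ₜ* Multiplicative (∀ p : Nat.Primes, @PadicInt (p : ℕ) ⟨p.2⟩))
    (ℓ : Nat.Primes) {m : ZH} (hm : Multiplicative.toAdd (e m) ℓ = 0) (t : ℕ) :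
    ∃ μ : ZH, μ ^ ((ℓ : ℕ) ^ t) = m := by
  classical
  -- at `p ≠ ℓ`, `ℓ` is a unit of `ℤ_p`
  have hunit : ∀ p : Nat.Primes, p ≠ ℓ → IsUnit ((ℓ : ℕ) : @PadicInt (p : ℕ) ⟨p.2⟩) := by
    intro p hp
    haveI : Fact (Nat.Prime (p : ℕ)) := ⟨p.2⟩
    rw [PadicInt.isUnit_iff]
    refine le_antisymm (PadicInt.norm_le_one _) (not_lt.mp fun hlt => ?_)
    rw [← Int.cast_natCast, PadicInt.norm_int_lt_one_iff_dvd] at hlt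
    have h2 : (p : ℕ) ∣ (ℓ : ℕ) := by exact_mod_cast hlt
    exact hp (Subtype.ext ((Nat.prime_dvd_prime_iff_eq p.2 ℓ.2).mp h2))
  let v : ∀ p : Nat.Primes, @PadicInt (p : ℕ) ⟨p.2⟩ := fun p =>
    if hp : p = ℓ then 0 else Multiplicative.toAdd (e m) p * ↑((hunit p hp).unit ^ t)⁻¹
  refine ⟨e.symm (Multiplicative.ofAdd v), ?_⟩
  apply e.injective
  rw [map_pow, ContinuousMulEquiv.apply_symm_apply, ← ofAdd_nsmul, ← ofAdd_toAdd (e m)]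
  congr 1
  funext p
  by_cases hp : p = ℓ
  · subst hp
    have hv : v p = 0 := by simp [v]
    rw [Pi.smul_apply, hv, smul_zero]
    exact hm.symm
  · haveI : Fact (Nat.Prime (p : ℕ)) := ⟨p.2⟩
    have hv : v p = Multiplicative.toAdd (e m) p * ↑((hunit p hp).unit ^ t)⁻¹ := by simp only [v, dif_neg hp]
    have hpow : ((ℓ : ℕ) : @PadicInt (p : ℕ) ⟨p.2⟩) ^ t = ↑((hunit p hp).unit ^ t) := by
      rw [Units.val_pow_eq_pow_val, IsUnit.unit_spec]
    rw [Pi.smul_apply, hv, nsmul_eq_mul, Nat.cast_pow, hpow, mul_left_comm, Units.mul_inv, mul_one]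

/-- **(A1)** For a continuous `K : Ẑ → Ẑ` whose value at `1` is NOT `ℓ`-divisible and `ν ≠ 1` divisible by every `r`
prime to `ℓ`: `K ν ≠ 1` (the `ℓ`-components multiply in the domain `ℤ_ℓ`). [cite: RibesZalesskii2010, Thm 2.7.1] -/
theorem apply_ne_one_of_ellType {ℓ : ℕ} (hℓ : ℓ.Prime) (K : ZH →ₜ* ZH)
    (hK : ¬ ∀ t : ℕ, ∃ μ : ZH, μ ^ (ℓ ^ t) = K (iotaZ (Multiplicative.ofAdd 1))) {ν : ZH}
    (hν : ∀ r : ℕ, 0 < r → ℓ.Coprime r → ∃ μ : ZH, μ ^ r = ν) (hν1 : ν ≠ 1) : K ν ≠ 1 := by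
  obtain ⟨e, he⟩ := ZHatCompletion.exists_continuousMulEquiv_padicProd
  let L : Nat.Primes := ⟨ℓ, hℓ⟩
  haveI : Fact (Nat.Prime (L : ℕ)) := ⟨L.2⟩
  have hνL : Multiplicative.toAdd (e ν) L ≠ 0 := by
    intro h0
    apply hν1
    apply e.injective
    rw [map_one, ← ofAdd_toAdd (e ν)]
    refine congrArg Multiplicative.ofAdd (funext fun p => ?_)
    by_cases hp : (p : ℕ) = ℓ
    · have : p = L := Subtype.ext hp
      rw [this, h0]; rfl
    · rw [toAdd_apply_eq_zero_of_ellType e hℓ hν p hp]; rfl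
  have hKL : Multiplicative.toAdd (e (K (iotaZ (Multiplicative.ofAdd 1)))) L ≠ 0 :=
    fun h0 => hK (ellDiv_of_toAdd_apply_eq_zero e L h0)
  intro hK1
  have h := toAdd_apply_continuousMonoidHom e he K ν L
  rw [hK1, map_one, toAdd_one, Pi.zero_apply] at h
  exact mul_ne_zero hνL hKL h.symm

/-- **(A2)** For a continuous `K : Ẑ → Ẑ` whose value at `1` IS `ℓ`-divisible and `ν` divisible by every `r` prime to
`ℓ`: `K ν = 1` (all components of the product vanish). [cite: RibesZalesskii2010, Thm 2.7.1] -/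
theorem apply_eq_one_of_ellType {ℓ : ℕ} (hℓ : ℓ.Prime) (K : ZH →ₜ* ZH)
    (hK : ∀ t : ℕ, ∃ μ : ZH, μ ^ (ℓ ^ t) = K (iotaZ (Multiplicative.ofAdd 1))) {ν : ZH}
    (hν : ∀ r : ℕ, 0 < r → ℓ.Coprime r → ∃ μ : ZH, μ ^ r = ν) : K ν = 1 := by
  obtain ⟨e, he⟩ := ZHatCompletion.exists_continuousMulEquiv_padicProd
  let L : Nat.Primes := ⟨ℓ, hℓ⟩
  apply e.injective
  rw [map_one, ← ofAdd_toAdd (e (K ν))]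
  refine congrArg Multiplicative.ofAdd (funext fun p => ?_)
  rw [toAdd_apply_continuousMonoidHom e he K ν p]
  by_cases hp : (p : ℕ) = ℓ
  · have : p = L := Subtype.ext hp
    rw [this, toAdd_apply_eq_zero_of_ellDiv e L hK, mul_zero]; rfl
  · rw [toAdd_apply_eq_zero_of_ellType e hℓ hν p hp, zero_mul]; rfl

/-- **Some prime sees a non-trivial element of `Ẑ`**: `m ≠ 1` is not `ℓ`-divisible for some prime `ℓ`.
[cite: RibesZalesskii2010, Thm 2.7.1] -/
theorem exists_prime_not_ellDiv {m : ZH} (hm : m ≠ 1) :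
    ∃ ℓ : ℕ, ℓ.Prime ∧ ¬ ∀ t : ℕ, ∃ μ : ZH, μ ^ (ℓ ^ t) = m := by
  obtain ⟨e, -⟩ := ZHatCompletion.exists_continuousMulEquiv_padicProd
  by_contra h
  push Not at h
  apply hm
  apply e.injective
  rw [map_one, ← ofAdd_toAdd (e m)]
  refine congrArg Multiplicative.ofAdd (funext fun p => ?_)
  rw [toAdd_apply_eq_zero_of_ellDiv e p (h p p.2)]; rfl

end ZHatArith

/-! ### §2 Continuous one-parameter homomorphisms `Ẑ → Ẑ` with prescribed value at `1` -/

section Homs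

/-- `ν ↦ k^ν`: a continuous `K : Ẑ → Ẑ` with `K(1) = k`. [cite: RibesZalesskii2010, Thm 2.7.1] -/
theorem exists_hom_apply_eq (k : ZH) : ∃ K : ZH →ₜ* ZH, K (iotaZ (Multiplicative.ofAdd 1)) = k :=
  ZHatCompletion.exists_continuousMonoidHom_apply_eq k

/-- Products, powers and inverses of one-parameter homomorphisms (`Ẑ` is commutative): `ν ↦ U ν · (K ν ^ n)⁻¹`.
[cite: RibesZalesskii2010, Thm 2.7.1] -/
theorem exists_hom_mul_pow_inv (U K : ZH →ₜ* ZH) (n : ℕ) :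
    ∃ U' : ZH →ₜ* ZH, ∀ ν, U' ν = U ν * (K ν ^ n)⁻¹ :=
  ⟨{ toFun := fun ν => U ν * (K ν ^ n)⁻¹
     map_one' := by rw [map_one, map_one, one_pow, inv_one, mul_one]
     map_mul' := fun a b => by
       rw [map_mul, map_mul, (commute_zh (K a) (K b)).mul_pow, mul_inv_rev,
         (commute_zh ((K b ^ n)⁻¹) ((K a ^ n)⁻¹)).eq, ← mul_assoc, mul_assoc (U a) (U b),
         (commute_zh (U b) ((K a ^ n)⁻¹)).eq, ← mul_assoc, mul_assoc]
     continuous_toFun := U.continuous.mul ((K.continuous.pow n).inv) }, fun _ => rfl⟩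

end Homs

/-! ### §3 TFV: twisted fixed vertices of a single shear -/

section TFV

/-- **TFV.** If `shear_M y = y · b^P` with `M ≠ 1`, then either `P = 1` and `y ∈ Π_v`, or `P = M` and `y = p·a·b^t` with
`p ∈ Π_v` (in the tree of the HNN splitting: a `shear_M`-fixed vertex is the base vertex or adjacent to it).  Proof: the
«FREE OFF `Π_v`» theorem of file 4 for `i = 1`, `U = 1`, `K(1) = M`; freeness off `Π_v` is CT0-EXOTIC (L4-t6
`mem_vertGp_of_shear_eq`) plus (A1) at a prime `ℓ` not dividing `M`. [cite: MochizukiAbsTopII2013, Prop 1.3 (v) p.12] -/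
theorem shear_eq_mul_bPow_imp {M P : ZH} (hM : M ≠ 1) {y : F₂hatT} (hy : shear M y = y * bPow P) :
    (P = 1 ∧ y ∈ vertGp) ∨ (P = M ∧ ∃ p ∈ vertGp, ∃ t : ZH, y = p * genA * bPow t) := by
  obtain ⟨ℓ, hℓ, hMℓ⟩ := exists_prime_not_ellDiv hM
  haveI : Fact ℓ.Prime := ⟨hℓ⟩
  obtain ⟨K, hK⟩ := exists_hom_apply_eq M
  let U0 : ZH →ₜ* ZH :=
    { toFun := fun _ => 1, map_one' := rfl, map_mul' := fun _ _ => (mul_one 1).symm,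
      continuous_toFun := continuous_const }
  have hx : shearPow 1 (K (iotaZ (Multiplicative.ofAdd 1))) y =
      (bPow (U0 (iotaZ (Multiplicative.ofAdd 1))))⁻¹ * y * bPow P := by
    rw [shearPow_apply, pow_one, hK, show U0 (iotaZ (Multiplicative.ofAdd 1)) = 1 from rfl, map_one, inv_one, one_mul]
    exact hy
  have hfree : ∀ (w : F₂hatT), w ∉ vertGp → ∀ ν : ZH, (∀ r : ℕ, 0 < r → ℓ.Coprime r → ∃ μ : ZH, μ ^ r = ν) →
      bPow (U0 ν) * shearPow 1 (K ν) w = w → ν = 1 := by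
    intro w hw ν hν hfix
    rw [show U0 ν = 1 from rfl, map_one, one_mul, shearPow_apply, pow_one] at hfix
    by_contra hν1
    exact hw (mem_vertGp_of_shear_eq (apply_ne_one_of_ellType hℓ K (hK.symm ▸ hMℓ) hν hν1) hfix)
  rcases mem_vertGp_or_of_shear_eq_conj_of_free_off (i := 1) U0 K P hx hfree with hyv | ⟨p, hp, t, rfl⟩
  · refine Or.inl ⟨?_, hyv⟩
    have h1 : shear M y = y := by
      have := shearPow_mem_vertGp (i := 1) M y hyv
      rwa [shearPow_apply, pow_one] at this
    rw [h1] at hy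
    have h2 : bPow P = 1 := by
      have := congrArg (fun z => y⁻¹ * z) hy
      simpa using this.symm
    exact bPow_injective (by rw [h2, map_one])
  · refine Or.inr ⟨?_, p, hp, t, rfl⟩
    have h1 : shear M p = p := by
      have := shearPow_mem_vertGp (i := 1) M p hp
      rwa [shearPow_apply, pow_one] at this
    rw [map_mul, map_mul, h1, shear_bPow] at hy
    have hy' : p * genA * (bPow M * bPow t) = p * genA * (bPow t * bPow P) := by
      have ha : shear M genA = genA * bPow M := shear_eta_of_zero M
      rw [ha] at hy
      simpa only [mul_assoc] using hy
    have h2 : bPow (M * t) = bPow (t * P) := by rw [map_mul, map_mul]; exact mul_left_cancel hy'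
    have h3 := bPow_injective h2
    rw [ZHatCompletion.mul_comm M t] at h3
    exact (mul_left_cancel h3).symm

end TFV

/-! ### §4 Cases B and C1 of CT2 -/

section Cases

/-- `ν ↦ (K ν)^n` as a continuous homomorphism. [cite: RibesZalesskii2010, Thm 2.7.1] -/
theorem exists_hom_pow (K : ZH →ₜ* ZH) (n : ℕ) : ∃ K' : ZH →ₜ* ZH, ∀ ν, K' ν = K ν ^ n :=
  ⟨{ toFun := fun ν => K ν ^ n
     map_one' := by rw [map_one, one_pow]
     map_mul' := fun a b => by rw [map_mul, (commute_zh (K a) (K b)).mul_pow]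
     continuous_toFun := K.continuous.pow n }, fun _ => rfl⟩

/-- An element of `F̂₂` commuting with a non-trivial `b`-power lies in `Π_e = b^Ẑ` (malnormality of `b^Ẑ`,
`bAxis_inf_conj_eq_bot_of_not_mem`). [cite: MochizukiAbsTopII2013, Prop 1.3 (ii) p.11] -/
theorem mem_nodeGp_of_commute_bPow {u : ZH} (hu : bPow u ≠ 1) {x : F₂hatT} (h : x * bPow u = bPow u * x) :
    x ∈ nodeGp := by
  by_contra hx
  have hbot := bAxis_inf_conj_eq_bot_of_not_mem (show x ∉ bAxis from hx)
  have hmem : bPow u ∈ bAxis ⊓ MulAut.conj x • bAxis := by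
    refine Subgroup.mem_inf.mpr ⟨bPow_mem_bAxis u, ?_⟩
    rw [Subgroup.mem_smul_pointwise_iff_exists]
    refine ⟨bPow u, bPow_mem_bAxis u, ?_⟩
    rw [MulAut.smul_def, MulAut.conj_apply, h, mul_inv_cancel_right]
  rw [hbot] at hmem
  exact hu (Subgroup.mem_bot.mp hmem)

/-- `p · a ∉ b^Ẑ` for `p ∈ Π_v` (the `a`-degree `ê` is `ι(1)` on it, `1` on `b^Ẑ`). [cite: MochizukiAbsTopII2013, Ex 1.1 (ii) p.9] -/
theorem mul_genA_not_mem_bAxis {p : F₂hatT} (hp : p ∈ vertGp) : p * genA ∉ bAxis := by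
  intro h
  have h1 := eHat_eq_one_of_mem_bAxis h
  rw [map_mul, eHat_eq_one_of_mem_vertGp hp, one_mul] at h1
  change eHat (eta (FreeGroup.of 0)) = 1 at h1
  rw [eHat_eta, expA_of_zero] at h1
  have h2 := iotaZ_injective (h1.trans (map_one iotaZ).symm)
  exact absurd (Multiplicative.ofAdd.injective h2) (by norm_num)

/-- **Case B (a prime where the slope is non-fibre).**  If at the prime `ℓ` none of `m = k^i`, `u`, `u·m⁻¹` is
`ℓ`-divisible, then every `y ∈ F̂₂` is `ℓ`-free for `σ_ν = b^{Uν}·shear^i(Kν)` (a fixed `y` gives, by TFV applied to `y⁻¹`,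
`Uν = 1` or `Uν = (Kν)^i`, contradicting (A1)); hence `x ∈ b^Ẑ` by «FREE EVERYWHERE». [cite: MochizukiAbsTopII2013, Prop 1.3 (viii) p.12] -/
theorem mem_nodeGp_of_conj_shear_eq_of_not_ellDiv {ℓ : ℕ} (hℓ : ℓ.Prime) (U K : ZH →ₜ* ZH)
    (hm : ¬ ∀ t : ℕ, ∃ μ : ZH, μ ^ (ℓ ^ t) = K (iotaZ (Multiplicative.ofAdd 1)) ^ i)
    (hu : ¬ ∀ t : ℕ, ∃ μ : ZH, μ ^ (ℓ ^ t) = U (iotaZ (Multiplicative.ofAdd 1)))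
    (hum : ¬ ∀ t : ℕ, ∃ μ : ZH, μ ^ (ℓ ^ t) =
      U (iotaZ (Multiplicative.ofAdd 1)) * (K (iotaZ (Multiplicative.ofAdd 1)) ^ i)⁻¹)
    {x : F₂hatT} (hx : shearPow i (K (iotaZ (Multiplicative.ofAdd 1))) x =
      (bPow (U (iotaZ (Multiplicative.ofAdd 1))))⁻¹ * x * bPow (U (iotaZ (Multiplicative.ofAdd 1)))) :
    x ∈ nodeGp := by
  haveI : Fact ℓ.Prime := ⟨hℓ⟩
  obtain ⟨Kp, hKp⟩ := exists_hom_pow K i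
  obtain ⟨U', hU'⟩ := exists_hom_mul_pow_inv U K i
  refine mem_nodeGp_of_shear_eq_conj_of_free (ℓ := ℓ) U K _ hx fun y ν hν hfix => ?_
  by_contra hν1
  have hM : K ν ^ i ≠ 1 := by rw [← hKp]; exact apply_ne_one_of_ellType hℓ Kp (by rw [hKp]; exact hm) hν hν1
  -- TFV for `y⁻¹`: `shear_M (y⁻¹) = y⁻¹ · b^{Uν}`
  have hfix' : shearPow i (K ν) y = (bPow (U ν))⁻¹ * y := eq_inv_mul_iff_mul_eq.mpr hfix
  have hy : shear (K ν ^ i) y⁻¹ = y⁻¹ * bPow (U ν) := by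
    rw [map_inv, ← shearPow_apply, hfix', mul_inv_rev, inv_inv]
  rcases shear_eq_mul_bPow_imp hM hy with ⟨h1, -⟩ | ⟨h2, -⟩
  · exact apply_ne_one_of_ellType hℓ U hu hν hν1 h1
  · refine apply_ne_one_of_ellType hℓ U' (by rw [hU']; exact hum) hν hν1 ?_
    rw [hU', h2, mul_inv_cancel]

/-- **Case C1 (a prime where `u` vanishes).**  If at `ℓ` the parameter `m = k^i` is not `ℓ`-divisible but `u` is, then
`σ_ν` is a PURE SHEAR for `ℓ`-type `ν` ((A2)), free off `Π_v` by CT0-EXOTIC; «FREE OFF `Π_v`» gives `x ∈ Π_v` — then `x`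
commutes with `b^u ≠ 1`, so `x ∈ b^Ẑ` — or `x = p·a·b^t`, which the CT2 equation turns into `b^u ∈ b^Ẑ ∩ (pa)b^Ẑ(pa)⁻¹ = 1`,
absurd. [cite: MochizukiAbsTopII2013, Prop 1.3 (viii) p.12] -/
theorem mem_nodeGp_of_conj_shear_eq_of_ellDiv {ℓ : ℕ} (hℓ : ℓ.Prime) (U K : ZH →ₜ* ZH)
    (hm : ¬ ∀ t : ℕ, ∃ μ : ZH, μ ^ (ℓ ^ t) = K (iotaZ (Multiplicative.ofAdd 1)) ^ i)
    (hu : ∀ t : ℕ, ∃ μ : ZH, μ ^ (ℓ ^ t) = U (iotaZ (Multiplicative.ofAdd 1)))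
    (hu1 : bPow (U (iotaZ (Multiplicative.ofAdd 1))) ≠ 1)
    {x : F₂hatT} (hx : shearPow i (K (iotaZ (Multiplicative.ofAdd 1))) x =
      (bPow (U (iotaZ (Multiplicative.ofAdd 1))))⁻¹ * x * bPow (U (iotaZ (Multiplicative.ofAdd 1)))) :
    x ∈ nodeGp := by
  haveI : Fact ℓ.Prime := ⟨hℓ⟩
  set u := U (iotaZ (Multiplicative.ofAdd 1)) with hudef
  set k := K (iotaZ (Multiplicative.ofAdd 1)) with hkdef
  obtain ⟨Kp, hKp⟩ := exists_hom_pow K i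
  have hfree : ∀ (y : F₂hatT), y ∉ vertGp → ∀ ν : ZH, (∀ r : ℕ, 0 < r → ℓ.Coprime r → ∃ μ : ZH, μ ^ r = ν) →
      bPow (U ν) * shearPow i (K ν) y = y → ν = 1 := by
    intro y hy ν hν hfix
    by_contra hν1
    rw [apply_eq_one_of_ellType hℓ U hu hν, map_one, one_mul, shearPow_apply] at hfix
    have hM : K ν ^ i ≠ 1 := by rw [← hKp]; exact apply_ne_one_of_ellType hℓ Kp (by rw [hKp]; exact hm) hν hν1
    exact hy (mem_vertGp_of_shear_eq hM hfix)
  rcases mem_vertGp_or_of_shear_eq_conj_of_free_off (ℓ := ℓ) U K u hx hfree with hxv | ⟨p, hp, t, rfl⟩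
  · -- `x ∈ Π_v`: the twist fixes `x`, so `x` commutes with `b^u`
    rw [shearPow_mem_vertGp i k x hxv] at hx
    refine mem_nodeGp_of_commute_bPow hu1 ?_
    have := congrArg (fun z => bPow u * z) hx
    simpa [← mul_assoc] using this.symm
  · -- `x = p·a·b^t`: impossible
    exfalso
    rw [map_mul, map_mul, shearPow_mem_vertGp i k p hp, shearPow_bPow, shearPow_eta_zero] at hx
    -- `b^u · p · a · b^m = p · a · b^u`
    have hcomm : bPow t * bPow u = bPow u * bPow t := by
      rw [← map_mul, ← map_mul, ZHatCompletion.mul_comm t u]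
    have hx' : p * (genA * bPow (k ^ i)) * bPow t = (bPow u)⁻¹ * (p * genA * bPow t) * bPow u := hx
    have key : bPow u * (p * genA) * bPow (k ^ i) = p * genA * bPow u := by
      calc bPow u * (p * genA) * bPow (k ^ i)
          = bPow u * (p * (genA * bPow (k ^ i)) * bPow t) * (bPow t)⁻¹ := by group
        _ = bPow u * ((bPow u)⁻¹ * (p * genA * bPow t) * bPow u) * (bPow t)⁻¹ := by rw [hx']
        _ = p * genA * (bPow t * bPow u) * (bPow t)⁻¹ := by group
        _ = p * genA * bPow u := by rw [hcomm]; group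
    -- hence `b^u = (pa) · b^{u m⁻¹} · (pa)⁻¹ ∈ b^Ẑ ∩ (pa) b^Ẑ (pa)⁻¹ = 1`
    have hconj : bPow u = (p * genA) * bPow (u * (k ^ i)⁻¹) * (p * genA)⁻¹ := by
      rw [map_mul, map_inv, ← mul_assoc, ← key]; group
    have hbot := bAxis_inf_conj_eq_bot_of_not_mem (mul_genA_not_mem_bAxis hp)
    have hmem : bPow u ∈ bAxis ⊓ MulAut.conj (p * genA) • bAxis := by
      refine Subgroup.mem_inf.mpr ⟨bPow_mem_bAxis u, ?_⟩
      rw [Subgroup.mem_smul_pointwise_iff_exists]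
      exact ⟨bPow (u * (k ^ i)⁻¹), bPow_mem_bAxis _, by rw [MulAut.smul_def, MulAut.conj_apply, ← hconj]⟩
    rw [hbot] at hmem
    exact hu1 (Subgroup.mem_bot.mp hmem)

end Cases

end Literature.AnabelianGeometry.AbsoluteAnabelian.AbsTopII.DehnTwist
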